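import Mathlib
import Summits.ValiantsHypothesis.ValiantsHypothesis.Theses.LacunarySymmetroid
import Summits.ValiantsHypothesis.ValiantsHypothesis.Theorems.MatrixDescartes.Negative.MatrixDescartesWitness24
import Summits.ValiantsHypothesis.ValiantsHypothesis.Theorems.LacunarySymmetroidMatrixDescartesCensusSupportDescartes

/-!
# LINE `null-core` (D-0145 skeleton, val-idea-5 GEN 3, lens = ANOMALY, LINE 2) — items `DoorA26` (stmt-ValiantsHypothesis-19979,
# BY NAME) and `MatrixDescartes` (stmt-ValiantsHypothesis-18050, row `m = 2` only)
# «THE EXCESS LIVES ON A NULL CORE»: a TIMELIKE (definite) middle letter caps a symmetric `(2,K)` pencil at the tropical capacity `4K − 7`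

HONEST FRAMING.  Nothing here proves `DoorA26`, V18, `MatrixDescartes` or Conjecture B; `VP ≠ VNP` is not moved by a law
candidate.  (v2, same gen) The ONLY three `sorry`s are the LAW stubs (`stub_law_five`, `stub_law_six`) and the residual door
(`stub_nullCoreDoor`) — the conjectural content; the `K = 2` mechanism is PROVED in this file (`pair_timelike_spacelike`: a
timelike letter against a spacelike one has exactly one positive root; `pair_two_roots_is_wrap`: two roots at a pair with a
positive definite letter force the other letter negative definite — a wrap; with `pencil_det_eval`, `negDef_of_entries`); (v3) the law
itself is PROVED for `K ≤ 4` (`law_of_le_two` vacuous, `law_three`/`law_four` Descartes-trivial: `4K − 7` = the support ceiling there), so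
`(2,5)` is its first non-vacuous format; (v4, critic #28 (a)) the law and the residual door quantify over INJECTIVE exponent maps (genuine
`K`-letter words) and the repeated-exponent case of `DoorA26` is discharged in the kernel (`posRoots_le_fourteen_of_not_injective`).
The law is a LOCATED law fitted to the census (symbolic-evo): it is located-TIGHT in both decided formats and
consistent in every format searched, but the engines never targeted its class, so its support is an anomaly, not evidence of truth.

THE MEASURED ANOMALY (this seat, exact rational arithmetic; instrument `lens/classcensus.py K` over ALL rows — not only record rows —
of the cell's located census `pub-symmetroid/census/records/2-K.jsonl`; «middle letter» = a letter whose exponent is neither minimal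
nor maximal; Lorentz dictionary `Sym₂(ℝ) ≅ ℝ^{1,2}`, `det` = the quadratic form: TIMELIKE letter `det Sₗ > 0` (definite),
SPACELIKE `det Sₗ < 0` (indefinite), NULL `det Sₗ = 0` (rank ≤ 1)).
* `(2,5)` (record 14; 1017 rows): rows with a TIMELIKE MIDDLE LETTER reach at most **13 = 4K − 7** (6 rows at 13, e.g.
  `THG8-K5TOWER13-m2K5-d0-1-3-15-135` with det-signature `−−+++`; 122 at 11, 36 at 12); all 208 rows at 14 have every middle
  letter spacelike, and in the 212 record rows with readable entries the middle letters are NEAR-NULL: the largest normalised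
  determinant `det Sₗ/‖Sₗ‖²` over middle letters has median `−1.8·10⁻¹⁴` and comes as close to the null cone as `−5.6·10⁻⁹³`
  (`T2G7-BOTHNULL14`), `−2.3·10⁻³⁴` (`E3G14-ENDBOTH14-…-150`).
* `(2,6)` (record 18; 1144 rows): timelike-middle rows reach at most **17 = 4K − 7** (6 rows, e.g. `E5G12-CGRAFT17-2-6-0-1-3-5-8-308`,
  signature `−−−+−+`; 125 rows at 14); all 540 rows at 18 have spacelike/near-null middle letters (332 with signature `+−−−−+`,
  208 with all six letters spacelike; max middle normalised det `−1.7·10⁻¹³`, median `−4·10⁻⁸`).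
* `(2,4)` (record 9 = 4K − 7): timelike-middle rows DO reach 9 (47 rows, signature `−−++`, the one-wrap family of LINE `nappe-walk`)
  — consistent, the law is not strict there.  `(2,7)`: record 22 (all seven letters spacelike); timelike-middle max 20 ≤ 21.
  `(2,8)`: record 25 = 4K − 7, timelike-middle max 21.  `(2,9)`: 28, timelike-middle 27 ≤ 29.  `(2,10)`: 30 ≤ 33 (one record row
  `E3-PLUS30` HAS a timelike middle letter — allowed, 30 < 4K − 7).  The tree's witnesses W24 (`−−−+`), T14 (`+−−−+`), G18
  (`+−−−−+`) all have spacelike middle letters, so no decided refutation (`not_dimensionLaw_two_four`, `not_definiteRule_two_four`,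
  pencil-level tropical lifting at W24, additive lifting at T14) touches the class.
* CONTROL (honest): pushing the near-null middle letter of a record row across the null cone by the minimal isotropic shift
  (relative size 10⁻⁹³…10⁻¹³) destroys the certified alternation — but so does the same shift in the opposite direction (exact
  sign counts on a 40-point-per-gap log grid: 14 → 4 timelike, 14 → 6 spacelike at `(2,5)`; 18 → 8 / 10 at `(2,6)`): the record
  pencils are 10⁻⁹⁰-residuals `AC − B²` of near-null curves, so this perturbation test is INCONCLUSIVE and is reported as such.
READING.  The symmetric excess over the general tropical capacity (`ζ(2,K) = 4K − 6 = T_gen(2,K) + 1` for `K = 5,6,7`,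
`KPlusLogSqLaw.tropRootLawAt_two_sharp` [kernel]) is carried by words whose core (all middle letters) is spacelike or null; the
seam mechanism typed in gen 2 (`Cruxes/MatrixDescartes/Lines/junction_ceiling.lean`: a corank-one = NULL host letter whose square
`H₁₂²` has a double zero opened into two simple zeros) is exactly a null-core phenomenon, and a timelike letter cannot host it.
At `K = 2` the mechanism is a theorem (pair lemmas below): a timelike letter next to a spacelike one yields exactly ONE positive
root, and two roots at a pair containing a timelike letter force the other letter to be timelike of the opposite nappe — a WRAP,
and wraps are Descartes-capped on every compression (LINE `nappe-walk`, `stub_wrap_root`: `w ≤ K − 1`).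

THE LAW (typed, general `K`; the located-tight instances are the stubs): `MiddleDefiniteDrop K`: a symmetric `(2,K)` lacunary
pencil with a timelike middle letter has at most `4K − 7` positive roots.  CONSEQUENCES: (i) `K = 6`: such pencils have ≤ 17, so
`DoorA26` reduces to the NULL-CORE class (`NullCoreDoor`: every middle letter spacelike or null ⇒ ≤ 19) — kernel composition
`doorA26_of_stubs : …Theses.LacunarySymmetroid.DoorA26` BY NAME; (ii) `K = 5`: the located value 13 is the law's value (tight);
(iii) an X2-style filter for the law registers (LAWFIT): a format-level law blind to letter TYPE cannot be sharp on classes —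
the class gap is ≥ 1 at `(2,5)` and `(2,6)`; (iv) engine guidance: search for door-breaking 19/20 only among null/spacelike cores
(where every located 18 already lives), and run the CHEAPEST FALSIFIER: a class-constrained engine run (tower/graft recipes with
one middle letter forced definite) at `(2,5)` — a timelike-middle FOURTEEN kills `stub_law_five` (`not_law_five_of_fourteen`), an
EIGHTEEN at `(2,6)` kills `stub_law_six`; both are far cheaper than the door itself.
WHY NOVEL (one line each vs the lines/cards in the tree): `definite-rule`/`dimension-law`/`slope-law` (val-idea cards) are
type-blind format values (refuted or open); `bottom-nappe-law` classifies ROOTS (definite-boundary vs middle), not LETTERS;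
`junction_ceiling` (this seat g2) types the seam at ONE null letter inside a graft, not a class law over words; `stamp.md` notes that
degree constraints force far letters to be null («spacelike end letters first») as search advice at `(2,9)`, with no count
attached; `sign-split.md` normalises a single negative-definite middle term in an exponential-sum model (a different regime: one
timelike letter assumed, no cap claimed); LINE `nappe-walk` (this gen) splits by rootless FRAMES (directions), not by letter
type — the two partitions are transverse (the one-wrap `(2,4)` family is timelike-middle AND frameless; the 208 all-spacelike
`(2,6)` rows have frames).  Searched: `rg -i 'middle letter|spacelike|timelike|null letter|definite middle'` over Cruxes/, Theses/,
Theorems/ (hits above only); literature: sign conditions on coefficient MATRICES of matrix polynomials bound real eigenvalues only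
through definiteness of the EXTREME coefficients (hyperbolic/definite pencils, Lancaster–Markus–Psarrakos type results) — a
middle-coefficient condition with a fewnomial count is not in print to my knowledge (query run in gen 2: "lacunary matrix
polynomial real eigenvalues sign pattern": no hit in corpus + galaxy).
BEARS ON: rung DoorA26 (19979) BY NAME; `MatrixDescartes`/V18 (18050) through the row `m = 2` and as a class filter for law fitting.
INSTRUMENT ROW: `classcensus.py K` → per format and per class (timelike-middle / all-spacelike / same-sign ends / wrap / frame /
posynomial) the located maximum and its multiplicity + the top row id per class; `margins.py K` → distribution of the normalised
determinants of middle letters over record rows (null-core margin); `middef_scan.py K` → the (inconclusive) push test.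
-/

set_option linter.dupNamespace false
set_option linter.unusedVariables false
set_option autoImplicit false

open Polynomial Matrix

namespace Summit.ValiantsHypothesis.ValiantsHypothesis.Cruxes.DoorA26.NullCore

open Summit.ValiantsHypothesis.ValiantsHypothesis.Theorems.MatrixDescartes.Negative (PosRootLawAt)

variable {K : ℕ}

/-! ## 0. Objects -/

/-- the lacunary symmetric `2 × 2` pencil `F = Σₗ x^{dₗ} Sₗ` (same expression as in `DoorA26`). -/
noncomputable def pencil (d : Fin K → ℕ) (S : Fin K → Matrix (Fin 2) (Fin 2) ℝ) : Matrix (Fin 2) (Fin 2) ℝ[X] :=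
  ∑ l, ((X : ℝ[X]) ^ d l) • (S l).map C

/-- number of distinct positive roots (the census currency). -/
noncomputable def posRoots (p : ℝ[X]) : ℕ := (p.roots.toFinset.filter (fun x => 0 < x)).card

/-- the value of the pencil at a real point. -/
def evalAt (d : Fin K → ℕ) (S : Fin K → Matrix (Fin 2) (Fin 2) ℝ) (x : ℝ) : Matrix (Fin 2) (Fin 2) ℝ :=
  ∑ l, (x ^ d l) • S l

/-- letter `l` is a MIDDLE letter of the support: some exponent lies strictly below it and some strictly above it. -/
def IsMiddle (d : Fin K → ℕ) (l : Fin K) : Prop := (∃ i, d i < d l) ∧ ∃ j, d l < d j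

/-- TIMELIKE (= definite, for a symmetric `2 × 2` matrix) letter: positive determinant. -/
def Timelike (M : Matrix (Fin 2) (Fin 2) ℝ) : Prop := 0 < M.det

/-- the word has a TIMELIKE MIDDLE LETTER. -/
def MiddleTimelike (d : Fin K → ℕ) (S : Fin K → Matrix (Fin 2) (Fin 2) ℝ) : Prop := ∃ l, IsMiddle d l ∧ Timelike (S l)

/-- **THE LAW** `MiddleDefiniteDrop K`: in a genuine `K`-letter word (distinct exponents) a timelike middle letter caps the count
at the general tropical capacity `4K − 7`.  (v4, critic crit-1 #28 (a)): the exponent map is required INJECTIVE — without it,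
splitting any middle letter `S_l = P + (S_l − P)` with `P ≻ 0` at a repeated exponent would make `law (K+1)` imply the TYPE-BLIND
format law «every `(2,K)` pencil has `≤ 4K − 3` positive roots», which is not the intended content.) -/
def MiddleDefiniteDrop (K : ℕ) : Prop :=
  ∀ (d : Fin K → ℕ) (S : Fin K → Matrix (Fin 2) (Fin 2) ℝ), Function.Injective d → (∀ l, (S l).IsSymm) →
    MiddleTimelike d S → posRoots (pencil d S).det ≤ 4 * K - 7

/-- **THE RESIDUAL DOOR** on the null/spacelike core (located: all 540 record rows at `(2,6)` live here, at 18). -/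
def NullCoreDoor : Prop :=
  ∀ (d : Fin 6 → ℕ) (S : Fin 6 → Matrix (Fin 2) (Fin 2) ℝ), Function.Injective d → (∀ l, (S l).IsSymm) →
    ¬ MiddleTimelike d S → posRoots (pencil d S).det ≤ 19

/-! ## 1. The `K = 2` mechanism (PROVED): a timelike letter in a PAIR -/

/-- evaluation commutes with the determinant of the pencil (proved). -/
theorem pencil_det_eval (d : Fin K → ℕ) (S : Fin K → Matrix (Fin 2) (Fin 2) ℝ) (t : ℝ) :
    (pencil d S).det.eval t = (evalAt d S t).det := by
  have h1 : (pencil d S).det.eval t = ((Polynomial.evalRingHom t).mapMatrix (pencil d S)).det := by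
    rw [← Polynomial.coe_evalRingHom, RingHom.map_det]
  rw [h1]
  congr 1
  ext i j
  simp [pencil, evalAt, Matrix.sum_apply, Matrix.smul_apply]
  exact Finset.sum_congr rfl (fun _ _ => mul_comm _ _)

/-- the pair pencil evaluated: `det (S + t^e T) = det T · y² + m · y + det S`, `y = t^e`. -/
theorem pair_det_eval (S T : Matrix (Fin 2) (Fin 2) ℝ) (e : ℕ) (t : ℝ) :
    (pencil ![0, e] ![S, T]).det.eval t
      = T.det * (t ^ e) ^ 2 + (S 0 0 * T 1 1 + S 1 1 * T 0 0 - S 0 1 * T 1 0 - S 1 0 * T 0 1) * t ^ e + S.det := by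
  rw [pencil_det_eval]
  unfold evalAt
  rw [Fin.sum_univ_two, Matrix.det_fin_two, Matrix.det_fin_two, Matrix.det_fin_two]
  simp
  ring

/-- Vieta for two distinct roots of `a y² + m y + c`: `a y₁ y₂ = c` and `m = −a (y₁ + y₂)`. -/
theorem quad_two_roots (a m c y₁ y₂ : ℝ) (h₁ : a * y₁ ^ 2 + m * y₁ + c = 0) (h₂ : a * y₂ ^ 2 + m * y₂ + c = 0)
    (hne : y₁ ≠ y₂) : a * y₁ * y₂ = c ∧ m = -(a * (y₁ + y₂)) := by
  have k1 : (y₁ - y₂) * (a * y₁ * y₂ - c) = 0 := by linear_combination y₂ * h₁ - y₁ * h₂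
  have k2 : (y₁ - y₂) * (a * (y₁ + y₂) + m) = 0 := by linear_combination h₁ - h₂
  have hsub : y₁ - y₂ ≠ 0 := sub_ne_zero.mpr hne
  constructor
  · have := (mul_eq_zero.mp k1).resolve_left hsub; linarith
  · have := (mul_eq_zero.mp k2).resolve_left hsub; linarith

/-- a real symmetric `2 × 2` matrix with negative `(0,0)` entry and positive determinant is negative definite. -/
theorem negDef_of_entries (T : Matrix (Fin 2) (Fin 2) ℝ) (hT : T.IsSymm) (h00 : T 0 0 < 0) (hdet : 0 < T.det) :
    (-T).PosDef := by
  have hsym : T 1 0 = T 0 1 := hT.apply 0 1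
  rw [Matrix.det_fin_two] at hdet
  refine Matrix.PosDef.of_dotProduct_mulVec_pos ?_ ?_
  · show (-T)ᴴ = -T
    rw [Matrix.conjTranspose_eq_transpose_of_trivial, Matrix.transpose_neg, hT.eq]
  · intro x hx
    have hq : star x ⬝ᵥ (-T) *ᵥ x = -(T 0 0 * x 0 ^ 2 + 2 * T 0 1 * x 0 * x 1 + T 1 1 * x 1 ^ 2) := by
      simp [Matrix.mulVec, dotProduct, Fin.sum_univ_two, Matrix.neg_apply, hsym]
      ring
    rw [hq]
    have key : T 0 0 * (T 0 0 * x 0 ^ 2 + 2 * T 0 1 * x 0 * x 1 + T 1 1 * x 1 ^ 2)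
        = (T 0 0 * x 0 + T 0 1 * x 1) ^ 2 + (T 0 0 * T 1 1 - T 0 1 * T 1 0) * x 1 ^ 2 := by rw [hsym]; ring
    by_cases hx1 : x 1 = 0
    · have hx0 : x 0 ≠ 0 := by
        intro h0; apply hx; ext i; fin_cases i <;> simp [h0, hx1]
      have : 0 < x 0 ^ 2 := by positivity
      rw [hx1]
      nlinarith [mul_neg_of_neg_of_pos h00 this]
    · have : 0 < x 1 ^ 2 := by positivity
      nlinarith [sq_nonneg (T 0 0 * x 0 + T 0 1 * x 1)]

/-- **(J1, was STUB, now PROVED)** a timelike letter against a spacelike letter: `det (S + x^e T)`, `e ≥ 1`, has EXACTLY ONE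
positive root (`det S · det T < 0`: Vieta forbids two positive roots of the quadratic in `y = x^e`, IVT gives one). -/
theorem pair_timelike_spacelike (S T : Matrix (Fin 2) (Fin 2) ℝ) (hS : S.IsSymm) (hT : T.IsSymm)
    (hSd : 0 < S.det) (hTd : T.det < 0) (e : ℕ) (he : 0 < e) :
    posRoots (pencil ![0, e] ![S, T]).det = 1 := by
  classical
  set p := (pencil ![0, e] ![S, T]).det with hp
  set m := S 0 0 * T 1 1 + S 1 1 * T 0 0 - S 0 1 * T 1 0 - S 1 0 * T 0 1 with hm
  have hev : ∀ t : ℝ, p.eval t = T.det * (t ^ e) ^ 2 + m * t ^ e + S.det := fun t => pair_det_eval S T e t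
  -- p ≠ 0
  have hp0 : p ≠ 0 := by
    intro h0
    have := hev 0
    rw [h0, Polynomial.eval_zero, zero_pow he.ne'] at this
    simp at this
    linarith
  -- a point where p < 0
  obtain ⟨R, hR1, hRneg⟩ : ∃ R : ℝ, 1 ≤ R ∧ p.eval R < 0 := by
    set Y := (|m| + S.det + 1) / (-T.det) with hY
    have hTpos : 0 < -T.det := by linarith
    refine ⟨max Y 1, le_max_right _ _, ?_⟩
    rw [hev]
    set y := (max Y 1) ^ e with hy
    have hy1 : 1 ≤ max Y 1 := le_max_right _ _
    have hyY : Y ≤ y := (le_max_left _ _).trans (le_self_pow₀ hy1 he.ne')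
    have hy1' : 1 ≤ y := one_le_pow₀ hy1
    have hT0 : T.det ≠ 0 := hTd.ne
    have hYdef : Y * (-T.det) = |m| + S.det + 1 := by rw [hY]; field_simp
    have h3 : (-T.det) * y ≥ |m| + S.det + 1 := by nlinarith
    have h4 : m * y ≤ |m| * y := by nlinarith [le_abs_self m]
    nlinarith
  -- existence of a positive root
  obtain ⟨r, ⟨hr0, hrR⟩, hr⟩ : ∃ r ∈ Set.Ioo (0:ℝ) (max R 0), p.eval r = 0 := by
    have hc : ContinuousOn (fun t => p.eval t) (Set.Icc 0 (max R 0)) := (Polynomial.continuous _).continuousOn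
    have h0 : p.eval 0 = S.det := by rw [hev, zero_pow he.ne']; ring
    have hR' : max R 0 = R := max_eq_left (by linarith)
    have := intermediate_value_Ioo' (le_max_right R 0) hc
    rw [hR', h0] at this
    rw [hR']
    exact this ⟨hRneg, hSd⟩
  -- uniqueness
  have huniq : ∀ x : ℝ, 0 < x → p.eval x = 0 → x = r := by
    intro x hx hx0
    by_contra hxr
    have hne : x ^ e ≠ r ^ e := by
      rcases lt_or_gt_of_ne hxr with h | h
      · exact (pow_lt_pow_left₀ h hx.le he.ne').ne
      · exact (pow_lt_pow_left₀ h hr0.le he.ne').ne'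
    have h₁ : T.det * (x ^ e) ^ 2 + m * x ^ e + S.det = 0 := by rw [← hev]; exact hx0
    have h₂ : T.det * (r ^ e) ^ 2 + m * r ^ e + S.det = 0 := by rw [← hev]; exact hr
    obtain ⟨hprod, -⟩ := quad_two_roots _ _ _ _ _ h₁ h₂ hne
    have : T.det * x ^ e * r ^ e < 0 := by
      have := mul_pos (pow_pos hx e) (pow_pos hr0 e)
      nlinarith
    linarith
  -- the filtered root set is {r}
  unfold posRoots
  rw [Finset.card_eq_one]
  refine ⟨r, ?_⟩
  ext x
  simp only [Finset.mem_filter, Multiset.mem_toFinset, Polynomial.mem_roots hp0, Finset.mem_singleton,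
    Polynomial.IsRoot.def]
  constructor
  · rintro ⟨hx0, hx⟩; exact huniq x hx hx0
  · rintro rfl; exact ⟨hr, hr0⟩

/-- **(J2, was STUB, now PROVED)** two positive roots at a pair whose bottom letter is positive definite force the top letter
to be NEGATIVE definite: the pair is a WRAP (Vieta: `det T > 0`, `m < 0`; two positive definite forms have `m = 2D(S,T) > 0`).
With LINE `nappe-walk` (`wrap_root`, `comp_descartes`: `w ≤ K − 1`) this is why timelike letters are cheap. -/
theorem pair_two_roots_is_wrap (S T : Matrix (Fin 2) (Fin 2) ℝ) (hS : S.PosDef) (hT : T.IsSymm) (e : ℕ)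
    (he : 0 < e) (h2 : posRoots (pencil ![0, e] ![S, T]).det = 2) : (-T).PosDef := by
  classical
  set p := (pencil ![0, e] ![S, T]).det with hp
  set m := S 0 0 * T 1 1 + S 1 1 * T 0 0 - S 0 1 * T 1 0 - S 1 0 * T 0 1 with hm
  have hev : ∀ t : ℝ, p.eval t = T.det * (t ^ e) ^ 2 + m * t ^ e + S.det := fun t => pair_det_eval S T e t
  -- two distinct positive roots
  unfold posRoots at h2
  obtain ⟨x₁, x₂, hne, hset⟩ := Finset.card_eq_two.mp h2
  have hmem : ∀ x, x ∈ (p.roots.toFinset.filter fun x => 0 < x) → 0 < x ∧ p.eval x = 0 := by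
    intro x hx
    rw [Finset.mem_filter, Multiset.mem_toFinset, Polynomial.mem_roots'] at hx
    exact ⟨hx.2, hx.1.2⟩
  obtain ⟨hx₁, hr₁⟩ := hmem x₁ (by rw [hset]; simp)
  obtain ⟨hx₂, hr₂⟩ := hmem x₂ (by rw [hset]; simp)
  have hne' : x₁ ^ e ≠ x₂ ^ e := by
    rcases lt_or_gt_of_ne hne with h | h
    · exact (pow_lt_pow_left₀ h hx₁.le he.ne').ne
    · exact (pow_lt_pow_left₀ h hx₂.le he.ne').ne'
  have h₁ : T.det * (x₁ ^ e) ^ 2 + m * x₁ ^ e + S.det = 0 := by rw [← hev]; exact hr₁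
  have h₂' : T.det * (x₂ ^ e) ^ 2 + m * x₂ ^ e + S.det = 0 := by rw [← hev]; exact hr₂
  obtain ⟨hprod, hsum⟩ := quad_two_roots _ _ _ _ _ h₁ h₂' hne'
  -- signs
  have hSdet : 0 < S.det := hS.det_pos
  have hy : 0 < x₁ ^ e * x₂ ^ e := mul_pos (pow_pos hx₁ e) (pow_pos hx₂ e)
  have hTdet : 0 < T.det := by
    by_contra hle; push Not at hle
    have : T.det * x₁ ^ e * x₂ ^ e ≤ 0 := by nlinarith
    linarith
  have hmneg : m < 0 := by
    have : 0 < T.det * (x₁ ^ e + x₂ ^ e) := mul_pos hTdet (by positivity)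
    linarith
  -- entries of S
  have hSsym : S 1 0 = S 0 1 := by
    have := hS.1.apply 0 1
    simpa using this
  have hTsym : T 1 0 = T 0 1 := hT.apply 0 1
  have hs00 : 0 < S 0 0 := by
    have := hS.dotProduct_mulVec_pos (x := Pi.single 0 1) (by simp)
    simpa [Matrix.mulVec, dotProduct, Fin.sum_univ_two] using this
  have hs11 : 0 < S 1 1 := by
    have := hS.dotProduct_mulVec_pos (x := Pi.single 1 1) (by simp)
    simpa [Matrix.mulVec, dotProduct, Fin.sum_univ_two] using this
  have hSdet' : S 0 1 * S 0 1 < S 0 0 * S 1 1 := by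
    rw [Matrix.det_fin_two, hSsym] at hSdet; linarith
  have hTdet' : T 0 1 * T 0 1 < T 0 0 * T 1 1 := by
    rw [Matrix.det_fin_two, hTsym] at hTdet; linarith
  -- T 0 0 < 0
  have ht00 : T 0 0 < 0 := by
    by_contra hge; push Not at hge
    have ht00' : 0 < T 0 0 := by
      rcases hge.lt_or_eq with h | h
      · exact h
      · exfalso; rw [← h] at hTdet'; nlinarith [sq_nonneg (T 0 1)]
    have ht11 : 0 < T 1 1 := by nlinarith [sq_nonneg (T 0 1)]
    -- A = S00 T11, B = S11 T00, P = S01 T01 : A B > P², A,B > 0 ⇒ A + B > 2P, i.e. m > 0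
    have hA : 0 < S 0 0 * T 1 1 := mul_pos hs00 ht11
    have hB : 0 < S 1 1 * T 0 0 := mul_pos hs11 ht00'
    have hABP : (S 0 1 * T 0 1) ^ 2 < (S 0 0 * T 1 1) * (S 1 1 * T 0 0) := by
      have e1 : (S 0 1 * T 0 1) ^ 2 = (S 0 1 * S 0 1) * (T 0 1 * T 0 1) := by ring
      have e2 : (S 0 0 * T 1 1) * (S 1 1 * T 0 0) = (S 0 0 * S 1 1) * (T 0 0 * T 1 1) := by ring
      rw [e1, e2]
      exact mul_lt_mul'' hSdet' hTdet' (mul_self_nonneg _) (mul_self_nonneg _)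
    have hmpos : 0 < m := by
      have hm' : m = S 0 0 * T 1 1 + S 1 1 * T 0 0 - 2 * (S 0 1 * T 0 1) := by rw [hm, hSsym, hTsym]; ring
      rw [hm']
      nlinarith [sq_nonneg (S 0 0 * T 1 1 - S 1 1 * T 0 0), sq_nonneg (S 0 0 * T 1 1 + S 1 1 * T 0 0 - 2 * (S 0 1 * T 0 1))]
    linarith
  exact negDef_of_entries T hT ht00 hTdet

/-! ## 1b. The law below its first non-vacuous format (PROVED): `K ≤ 2` vacuous, `K = 3, 4` Descartes-trivial

For `K ≤ 2` a word has no middle letter.  For `K = 3, 4` the law's constant `4K − 7` EQUALS the Descartes ceiling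
`K(K+1)/2 − 1` of ANY `(2,K)` pencil (5, resp. 9), so the law holds there with no hypothesis used (tree:
`Census.posRoots_two_le_of_card_pairSums`).  The first format where the law says something is `(2,5)`: 13 < 14 — `stub_law_five`.
(The cell's sharper `K = 3` clause «definite middle letter ⇒ ≤ 4» (ARG-3) and the REFUTED `K = 4` clause «⇒ ≤ 8» (C-g3-2(4,9))
are NOT instances of this law.) -/

/-- the pair-sum set of a support is the image of the canonical pairs `i ≤ j` — hence has at most `K(K+1)/2` elements. -/
theorem card_pairSums_le_canonical (K : ℕ) (d : Fin K → ℕ) :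
    ((Finset.univ : Finset (Fin K × Fin K)).image (fun p => d p.1 + d p.2)).card ≤
      ((Finset.univ : Finset (Fin K × Fin K)).filter (fun p => p.1 ≤ p.2)).card := by
  calc ((Finset.univ : Finset (Fin K × Fin K)).image (fun p => d p.1 + d p.2)).card
      ≤ ((((Finset.univ : Finset (Fin K × Fin K)).filter (fun p => p.1 ≤ p.2))).image
          (fun p => d p.1 + d p.2)).card := by
        refine Finset.card_le_card ?_
        intro s hs
        simp only [Finset.mem_image, Finset.mem_univ, true_and, Finset.mem_filter] at hs ⊢
        obtain ⟨p, rfl⟩ := hs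
        rcases le_total p.1 p.2 with h | h
        · exact ⟨p, h, rfl⟩
        · exact ⟨p.swap, by simpa using h, by simp [add_comm]⟩
    _ ≤ _ := Finset.card_image_le

/-- Descartes on the support, in the line's currency: `posRoots (det F) ≤ B` whenever the canonical pairs number `≤ B + 1`. -/
theorem posRoots_le_of_canonicalPairs {K : ℕ} (hK : 0 < K) (B : ℕ)
    (hB : ((Finset.univ : Finset (Fin K × Fin K)).filter (fun p => p.1 ≤ p.2)).card ≤ B + 1)
    (d : Fin K → ℕ) (S : Fin K → Matrix (Fin 2) (Fin 2) ℝ) : posRoots (pencil d S).det ≤ B := by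
  unfold posRoots pencil
  exact Summit.ValiantsHypothesis.ValiantsHypothesis.Theorems.LacunarySymmetroidMatrixDescartes.Census.posRoots_two_le_of_card_pairSums
    hK d ((card_pairSums_le_canonical K d).trans hB) S

/-- no middle letter in a word of length `≤ 2`. -/
theorem not_isMiddle_of_le_two {K : ℕ} (hK : K ≤ 2) (d : Fin K → ℕ) (l : Fin K) : ¬ IsMiddle d l := by
  rintro ⟨⟨i, hi⟩, j, hj⟩
  have hij : i.val ≠ j.val := fun h => by
    have : i = j := Fin.ext h
    subst this; exact lt_asymm hi hj
  have hil : i.val ≠ l.val := fun h => by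
    have : i = l := Fin.ext h
    subst this; exact lt_irrefl _ hi
  have hlj : l.val ≠ j.val := fun h => by
    have : l = j := Fin.ext h
    subst this; exact lt_irrefl _ hj
  have h1 := i.isLt; have h2 := j.isLt; have h3 := l.isLt
  omega

/-- **the law for `K ≤ 2`** (vacuous: no middle letter; the `K = 2` MECHANISM is §1's `pair_timelike_spacelike`). -/
theorem law_of_le_two {K : ℕ} (hK : K ≤ 2) : MiddleDefiniteDrop K :=
  fun d _ _ _ hm => by obtain ⟨l, hl, _⟩ := hm; exact (not_isMiddle_of_le_two hK d l hl).elim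

/-- **the law at `K = 3`** (Descartes-trivial: `4·3 − 7 = 5 = 6 − 1`). -/
theorem law_three : MiddleDefiniteDrop 3 := by
  intro d S _ _ _
  have h : posRoots (pencil d S).det ≤ 5 := posRoots_le_of_canonicalPairs (by norm_num) 5 (by decide) d S
  omega

/-- **the law at `K = 4`** (Descartes-trivial: `4·4 − 7 = 9 = 10 − 1`; the record `ζ(2,4) = 9` is attained by BOTH classes —
the 47 interior-definite wrap nines and the 208 all-indefinite-middle nines — so nothing sharper is true at `K = 4`). -/
theorem law_four : MiddleDefiniteDrop 4 := by
  intro d S _ _ _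
  have h : posRoots (pencil d S).det ≤ 9 := posRoots_le_of_canonicalPairs (by norm_num) 9 (by decide) d S
  omega

/-- a `6`-word with a REPEATED exponent is a `(2,5)` pencil in disguise: its pair sums number at most 15. -/
theorem card_pairSums_le_fifteen_of_not_injective (d : Fin 6 → ℕ) (hd : ¬ Function.Injective d) :
    ((Finset.univ : Finset (Fin 6 × Fin 6)).image (fun p => d p.1 + d p.2)).card ≤ 15 := by
  obtain ⟨i, j, hdij, hij⟩ := Function.not_injective_iff.mp hd
  have hval : ∀ k, ∃ k', d k = (d ∘ j.succAbove) k' := by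
    intro k
    by_cases hk : k = j
    · obtain ⟨z, hz⟩ := Fin.exists_succAbove_eq hij
      exact ⟨z, by rw [Function.comp_apply, hz, hdij, hk]⟩
    · obtain ⟨z, hz⟩ := Fin.exists_succAbove_eq hk
      exact ⟨z, by rw [Function.comp_apply, hz]⟩
  calc ((Finset.univ : Finset (Fin 6 × Fin 6)).image (fun p => d p.1 + d p.2)).card
      ≤ ((Finset.univ : Finset (Fin 5 × Fin 5)).image
          (fun p => (d ∘ j.succAbove) p.1 + (d ∘ j.succAbove) p.2)).card := by
        refine Finset.card_le_card ?_
        intro s hs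
        simp only [Finset.mem_image, Finset.mem_univ, true_and] at hs ⊢
        obtain ⟨p, rfl⟩ := hs
        obtain ⟨a, ha⟩ := hval p.1
        obtain ⟨b, hb⟩ := hval p.2
        exact ⟨(a, b), by rw [ha, hb]⟩
    _ ≤ ((Finset.univ : Finset (Fin 5 × Fin 5)).filter (fun p => p.1 ≤ p.2)).card :=
        card_pairSums_le_canonical 5 (d ∘ j.succAbove)
    _ = 15 := by decide

/-- hence a `(2,6)` word with a repeated exponent has at most 14 positive roots (Descartes on ≤ 15 monomials) — the
non-injective case of `DoorA26` is free. -/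
theorem posRoots_le_fourteen_of_not_injective (d : Fin 6 → ℕ) (hd : ¬ Function.Injective d)
    (S : Fin 6 → Matrix (Fin 2) (Fin 2) ℝ) : posRoots (pencil d S).det ≤ 14 := by
  unfold posRoots pencil
  exact Summit.ValiantsHypothesis.ValiantsHypothesis.Theorems.LacunarySymmetroidMatrixDescartes.Census.posRoots_two_le_of_card_pairSums
    (by norm_num) d (card_pairSums_le_fifteen_of_not_injective d hd) S

/-! ## 2. The law stubs (conjectural; located-tight) and the residual door -/

/-- **THE ANOMALY TYPED** (first stub of the line): at `(2,5)` a timelike middle letter caps the count at 13 — the located class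
maximum (6 rows at 13 among 1017; record 14 only on spacelike/null cores).  Kill: a timelike-middle fourteen. -/
theorem stub_law_five : MiddleDefiniteDrop 5 := by
  sorry

/-- the law at the door's format: timelike middle letter ⇒ ≤ 17 (located class maximum 17, 6 rows among 1144). -/
theorem stub_law_six : MiddleDefiniteDrop 6 := by
  sorry

/-- the residual door on null/spacelike cores. -/
theorem stub_nullCoreDoor : NullCoreDoor := by
  sorry

/-! ## 3. Kernel composition to the item, BY NAME -/

/-- the door's format row from the law at `K = 6` and the residual door. -/
theorem posRootLawAt_two_six_of_law (h6 : MiddleDefiniteDrop 6) (hN : NullCoreDoor) : PosRootLawAt 2 6 19 := by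
  intro d S hS
  show posRoots (pencil d S).det ≤ 19
  by_cases hd : Function.Injective d
  · by_cases hm : MiddleTimelike d S
    · have h17 := h6 d S hd hS hm
      omega
    · exact hN d S hd hS hm
  · have h14 := posRoots_le_fourteen_of_not_injective d hd S
    omega

/-- the route item `DoorA26` (stmt-ValiantsHypothesis-19979), BY NAME. -/
theorem doorA26_of_law (h6 : MiddleDefiniteDrop 6) (hN : NullCoreDoor) :
    Summit.ValiantsHypothesis.ValiantsHypothesis.Theses.LacunarySymmetroid.DoorA26 :=
  posRootLawAt_two_six_of_law h6 hN

/-- zero-hypothesis composition through the stubs (the D-0145 `…_of` theorem). -/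
theorem doorA26_of_stubs : Summit.ValiantsHypothesis.ValiantsHypothesis.Theses.LacunarySymmetroid.DoorA26 :=
  doorA26_of_law stub_law_six stub_nullCoreDoor

/-! ## 4. Kill switches (what refutes which stub) -/

/-- a timelike-middle `(2,5)` pencil with fourteen positive roots kills the typed anomaly. -/
theorem not_law_five_of_fourteen (d : Fin 5 → ℕ) (S : Fin 5 → Matrix (Fin 2) (Fin 2) ℝ) (hd : Function.Injective d)
    (hS : ∀ l, (S l).IsSymm)
    (hm : MiddleTimelike d S) (h14 : 14 ≤ posRoots (pencil d S).det) : ¬ MiddleDefiniteDrop 5 := by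
  intro h
  have := h d S hd hS hm
  omega

/-- a timelike-middle `(2,6)` pencil with eighteen positive roots kills the law at the door's format. -/
theorem not_law_six_of_eighteen (d : Fin 6 → ℕ) (S : Fin 6 → Matrix (Fin 2) (Fin 2) ℝ) (hd : Function.Injective d)
    (hS : ∀ l, (S l).IsSymm)
    (hm : MiddleTimelike d S) (h18 : 18 ≤ posRoots (pencil d S).det) : ¬ MiddleDefiniteDrop 6 := by
  intro h
  have := h d S hd hS hm
  omega

/-- one symmetric `(2,6)` pencil with twenty positive roots kills the pair (law at six, residual door). -/
theorem not_both_of_twenty (d : Fin 6 → ℕ) (S : Fin 6 → Matrix (Fin 2) (Fin 2) ℝ) (hS : ∀ l, (S l).IsSymm)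
    (h20 : 20 ≤ posRoots (pencil d S).det) : ¬ (MiddleDefiniteDrop 6 ∧ NullCoreDoor) := by
  rintro ⟨h6, hN⟩
  have := posRootLawAt_two_six_of_law h6 hN d S hS
  unfold posRoots pencil at h20
  omega

end Summit.ValiantsHypothesis.ValiantsHypothesis.Cruxes.DoorA26.NullCore
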